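import Literature.NumberTheory.EllipticCurves.Rank1Residual.PrintShape
import Literature.NumberTheory.EllipticCurves.Rank1Residual.Predicates
import Literature.NumberTheory.EllipticCurves.Rank1Residual.Typed.X7
import Literature.NumberTheory.EllipticCurves.Rank1Residual.PeriodUnitProofs
import Literature.NumberTheory.EllipticCurves.CuspFormLFunction
import HarnessLib

/-!
# Fouquet–Wan (arXiv:2107.13726, PREPRINT), Cor. 1.10 / Cor. 5.4: the CLAIMED `p`-part of BSD in analytic rank `0`
# from Kato's main conjecture at ANY level with a non-split ramified Steinberg prime — as an explicitly
# labelled OPEN hypothesis, and the conditional class theorems it would give on corner X7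

HONEST FRAMING (cell `bsd-ssimc`, seat `bsd-ssimc-lev` gen 5, order W-lev-9 of TARGET v7.2–v9): an
UNREFEREED preprint enters the tree only as an explicitly labelled OPEN hypothesis, NEVER as a theorem;
nothing here is asserted about any curve; nothing is booked. The pattern is that of
`BurungaleSkinnerTianWan2024/SupersingularPPartOPEN.lean` (`thm15_pPart_OPEN` + conditional X6 class
theorems): this file records in the kernel WHAT the route `SignedLowerHalves` crux
`KobayashiLowerHalfLargeImage` (item stmt-BirchSwinnertonDyer-19001; planner skeleton stub
`stub_fwLocus`) would rest on if the Fouquet–Wan claim were refereed, at the exact locus the claim covers.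

Source (read 2026-08-25 from the held text `paper:arxiv-2107.13726`, chunks p0005 = Thm. 1.7,
p0006 = Cor. 1.10 + the period remark, p0053 = Thm. 5.1 / Cor. 5.4, p0073 = Thm. 7.32; arXiv 2021;
Crossref/zbMATH/Semantic Scholar 2026-08-25: no journal version). O. Fouquet, X. Wan, *The Iwasawa Main
Conjecture for universal families of modular motives* [FouquetWan2021]. Verbatim (p0053):

> **Theorem 5.1.** Let `p ≥ 3` be a prime. Let `f ∈ S_k(Γ₀(Np^r))` be a normalized eigencuspform with
> `k ≥ 2`. Assume that `ρ̄_f` satisfies the following properties. • The `G_{ℚ,Σ}`-representation `ρ̄_f`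
> is absolutely irreducible. • The semisimplification of `ρ̄_f|G_{ℚ_p}` is not equal to
> `χ̄ ⊕ χ̄_cyc χ̄`. • There exists `ℓ ∤ p` such that `ρ̄_f|G_{ℚ_ℓ}` is a ramified extension
> `0 → μχ_cyc^{1−k/2} → ρ̄|G_{ℚ_ℓ} → μχ_cyc^{−k/2} → 0` where `μ : G_{ℚ_ℓ} → {±1}` is an unramified
> character. If moreover `ρ̄_f|G_{ℚ_p}` is irreducible, then `μ` is not trivial. If `ℓ ∥ N`, then
> the zeta morphism is an isomorphism […]. Equivalently, conjecture (ConjIMC) [Kato's main conjecture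
> 12.10 for `M(f)`] is true.
> **Corollary 5.4.** Let `A/ℚ` be an abelian variety of `GL₂`-type of conductor `N` […] Let `f` be the
> associated weight two cusp form. Assume that `L(A,1) ≠ 0` and that `f` satisfies the assumptions of
> theorem 5.1. Then `v_p(L(A,1)/Ω_f) = v_p(#Ш(A/ℚ)[p^∞] · ∏_{q∣N} Tam_q(A/ℚ))`. Equivalently, the
> `p`-part of the Birch and Swinnerton-Dyer Conjecture for `A` holds.
> (p0006, after Cor. 1.10 = the same statement in the introduction:) Note that the period appearing in
> the above corollary is the one for the associated modular form. If `A` is an elliptic curve over `ℚ`,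
> then this period is the same as the Neron period up to the Manin constant.

Transcription for an ELLIPTIC CURVE (`A = E`, `d = 1`, `f` its newform of level `N_E`, trivial
character so `k = 2`) at a prime `p` of GOOD SUPERSINGULAR reduction — the special case the cell needs
(corner X7 / X6 of the rank-≤1 residual programme): `p ≠ 2`; `p ∤ N` is `W.HasGoodReductionAtPrime p`
(so `r = 0`); "`ρ̄|G_{ℚ_p}` irreducible" holds at an odd supersingular prime (`p ∣ a_p`; Serre 1972
Prop. 12 even gives global irreducibility, tree theorem `hasIrreducibleModPGaloisRep_of_dvd_frobeniusTrace`),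
so the second bullet is automatic and the third bullet requires `μ` NON-trivial; for `k = 2` the third
bullet at a prime `ℓ ≠ p` reads: `E` has multiplicative reduction at `ℓ` (the extension shape, Tate
curve), `μ(Frob_ℓ) = a_ℓ = −1` (NON-SPLIT multiplicative) and the extension is RAMIFIED, i.e. `E[p]`
is ramified at `ℓ`, i.e. `p ∤ ord_ℓ(Δ_min)` (Tate); "`ρ̄` absolutely irreducible" = `Irr W p`
(irreducible and odd, `p` odd); "`L(A,1) ≠ 0`" = `W.analyticRank = 0`; `Ω_f` = the lattice period
`Ω⁺_f = plusPeriod f` of the newform (FW's remark: "the one for the associated modular form … the same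
as the Neron period up to the Manin constant"); conclusion = the rank-`0` print shape with that period:
`L(E,1)/Ω⁺_f` is a rational `q` with `ord_p q = ord_p #Ш + ord_p ∏_ℓ c_ℓ` (`#Ш = W.shaOrder`, finite
in analytic rank `0` by GZK; FW write `#Ш[p^∞]`, same `p`-adic valuation).
-- TODO(general form): FW's Thm. 5.1 / Cor. 5.4 allow any reduction at `p` (`f ∈ S_k(Γ₀(Np^r))`,
-- "arbitrary reduction type at p"), any weight `k ≥ 2`, `GL₂`-type `A`, and conclude Kato's main
-- conjecture itself (their (ConjIMC)); the tree has no Kato-main-conjecture predicate for `E` at `p`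
-- (only the per-datum `KatoDescentDatum.Conj1210`), so only the rank-0 BSD consequence is typed here.

AUDIT POINTER (the reason this is an OPEN binder and not a fact; cell memo `bsd-ssimc-lev/MEMO-5.md`
§2 = W-lev-9 part 1): at a non-ordinary `p` the Eisenstein side of FW's proof (Thm. 7.32/4.41, the
Greenberg main conjecture over an auxiliary imaginary quadratic field) is built on Wan's 2015 preprint
"Iwasawa Main Conjecture for Supersingular Elliptic curves" ([XinWanIMC] of their bibliography =
arXiv:1411.6352, "no longer intended for publication", Burungale–Skinner–Tian–Wan 2024 Rem. 1.4 (i)),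
on Wan, Algebra Number Theory 14 (2020) (square-free level in its global theorem; general principal
series in its local Lemmas 7.4–7.7), on Eischen–Wan 2016, Ikeda 1994, Hu (IMRN 2018) and Pan (2019);
the local triple-product computation at a prime of ADDITIVE, potentially multiplicative reduction
(Steinberg twisted by a ramified quadratic character, split in the auxiliary field) is not written in
any of these sources.

Then the conditional theorems (closing nothing): `bsdp_of_cor54_OPEN_of_analyticRank_eq_zero` — IF the
claim holds, then at every pair `(E,p)` with `p` an odd good supersingular prime, `ord_{s=1}L(E,s) = 0`
and a non-split multiplicative prime `ℓ ≠ p` with `p ∤ ord_ℓ(Δ_min)`, Miller's `BSD(E,p)` follows from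
PUBLISHED inputs by name (modularity `exists_isNewformOf`, GZK, and the Néron-vs-lattice period
comparison `realPeriodRat_eq_unit_mul_plusPeriod[_three]`, Greenberg–Vatsal 2000 Rem. 3.4 / Mazur 1978
Cor. 4.1 / Abbes–Ullmo / Edixhoven, which turns `Ω⁺_f` into `Ω_E` up to a `p`-adic unit); and its
corner-X7 reading `X7.bsdp_of_cor54_OPEN_of_analyticRank_eq_zero`.

## References
* [FouquetWan2021] arXiv:2107.13726, Thm. 1.7 (p. 5), Cor. 1.10 (p. 6), Thm. 5.1 / Cor. 5.4 (p. 53), Thm. 7.32 (p. 73).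
* [Kato2004] K. Kato, Astérisque 295 (2004), Conj. 12.10 (FW's (ConjIMC)/(ConjIMCweak)).
* [BurungaleSkinnerTianWan2024] arXiv:2409.01350v2, Rem. 1.4 (i) (status of Wan's 2014/2015 preprint).
* [GreenbergVatsal2000] §3 Remark 3.4; [Mazur1978] Cor. 4.1 (the period comparison facts).
* [Miller2011LMS] §1 and Def. 1.1 (`BSD(E,p)`).
-/

noncomputable section

open scoped Classical MatrixGroups ModularForm

open CongruenceSubgroup WeierstrassCurve Literature.NumberTheory.EllipticCurves
  Literature.NumberTheory.EllipticCurves.ModularForms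
  Literature.NumberTheory.EllipticCurves.Rank1Residual

namespace Literature.NumberTheory.EllipticCurves.FouquetWan2021

/-- **OPEN HYPOTHESIS — UNREFEREED PREPRINT (Fouquet–Wan, arXiv:2107.13726, 2021), Cor. 5.4 (= Cor.
1.10) with Thm. 5.1, for an elliptic curve at a good supersingular prime.** "Let `A/ℚ` be an abelian
variety of `GL₂`-type of conductor `N` […] `f` the associated weight two cusp form. Assume that
`L(A,1) ≠ 0` and that `f` satisfies the assumptions of theorem 5.1 [`p ≥ 3`; `ρ̄_f` absolutely
irreducible; `ρ̄_f|G_{ℚ_p}`ˢˢ `≠ χ̄ ⊕ χ̄_cyc χ̄`; there is `ℓ ∤ p`, `ℓ ∥ N`, with `ρ̄_f|G_{ℚ_ℓ}` a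
RAMIFIED extension of `μχ_cyc^{−k/2}` by `μχ_cyc^{1−k/2}`, `μ` unramified quadratic, and `μ`
non-trivial if `ρ̄_f|G_{ℚ_p}` is irreducible]. Then `v_p(L(A,1)/Ω_f) = v_p(#Ш(A/ℚ)[p^∞] · ∏_{q∣N}
Tam_q(A/ℚ))`." Transcribed for a globally minimal `W` (`A = E`, `k = 2`) at an ODD prime `p` of GOOD
SUPERSINGULAR reduction (`p ∣ a_p`; then `ρ̄|G_{ℚ_p}` is irreducible, so the `ℓ`-condition is: a prime
`ℓ ≠ p` of NON-SPLIT multiplicative reduction with `E[p]` ramified, `p ∤ ord_ℓ(Δ_min)`), `E[p]`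
irreducible (`Irr W p`, automatic here but printed), `ord_{s=1} L(E,s) = 0`, and the newform `f` of
`E` at level `N_E`: `L(E,1)/Ω⁺_f` (`Ω⁺_f = plusPeriod f`, "the period … for the associated modular
form") is a rational `q` with `ord_p q = ord_p #Ш(E) + ord_p ∏_ℓ c_ℓ(E)`. NEVER cite this `Prop` as a
theorem (FRESHNESS 2026-08-25: arXiv only; its non-ordinary Eisenstein side rests on Wan's withdrawn
2015 preprint, see the module docstring); take it as an explicit hypothesis.
[claim: FouquetWan2021, status: under-review] -/
def cor54_pPart_rankZero_OPEN : Prop :=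
  ∀ (W : WeierstrassCurve ℚ) [W.IsElliptic] [W.IsGloballyMinimal] (p : ℕ) [Fact p.Prime],
    p ≠ 2 → W.HasGoodReductionAtPrime p → (p : ℤ) ∣ W.frobeniusTrace p → Irr W p →
    (∃ (ℓ : ℕ) (_ : Fact ℓ.Prime), ℓ ≠ p ∧ W.HasMultiplicativeReductionAtPrime ℓ ∧
        ¬ W.HasSplitMultiplicativeReductionAtPrime ℓ ∧ ¬ p ∣ padicValInt ℓ W.minimalDiscriminantInt) →
    W.analyticRank = 0 →
    ∀ [NeZero (W.conductorNorm ℤ)] (f : CuspForm (Gamma0 (W.conductorNorm ℤ)) 2), IsNewformOf W f →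
      ∃ q : ℚ, W.entireLFunction 1 / ((plusPeriod f : ℝ) : ℂ) = (q : ℂ) ∧
        padicValRat p q = (padicValNat p W.shaOrder : ℤ) + padicValNat p W.tamagawaProduct

/-- **Conditional rank-0 theorem on the Fouquet–Wan locus (CLOSES NOTHING).** IF the claimed Cor. 5.4
of Fouquet–Wan (`hFW_OPEN`, unrefereed) holds, then for a globally minimal `W/ℚ`, an odd prime `p` of
good supersingular reduction (`p ∣ a_p`), a prime `ℓ ≠ p` of non-split multiplicative reduction with
`p ∤ ord_ℓ(Δ_min)`, and `ord_{s=1} L(E,s) = 0`, Miller's `BSD(E,p)` follows from PUBLISHED inputs by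
name: modularity (`hnf`, a newform of `E` at level `N_E`), GZK (`hGZK`), and the period comparison
`Ω_E = u · Ω⁺_f` with `|u|_p = 1` (`h5` at `p ≥ 5`, `h3` at `p = 3`; Greenberg–Vatsal Rem. 3.4 with
the Manin constant prime to `p ∤ N`), which converts `L(E,1)/Ω⁺_f = q` into `L(E,1)/Ω_E = q/u` of the
same valuation; `E[p]` is irreducible at an odd supersingular prime (Serre 1972 Prop. 12, tree theorem).
Then the cell's bridge `bsdp_of_padicVal_printShape_rankZero`. CONDITIONAL; records what the FW locus
of the X7/X6 rank-0 residue rests on. [claim: FouquetWan2021, status: under-review]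
[cite: GreenbergVatsal2000, §3, Remark 3.4] [cite: Serre1972, §1.11 Prop. 12] [cite: Miller2011LMS, §1 and Def. 1.1] -/
theorem bsdp_of_cor54_OPEN_of_analyticRank_eq_zero (hFW_OPEN : cor54_pPart_rankZero_OPEN)
    (hnf : exists_isNewformOf) (hGZK : rank_eq_analyticRank_of_analyticRank_le_one)
    (h5 : realPeriodRat_eq_unit_mul_plusPeriod) (h3 : realPeriodRat_eq_unit_mul_plusPeriod_three)
    (W : WeierstrassCurve ℚ) [W.IsElliptic] [W.IsGloballyMinimal] (p : ℕ) [Fact p.Prime]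
    (hp : p ≠ 2) (hgood : W.HasGoodReductionAtPrime p) (hss : (p : ℤ) ∣ W.frobeniusTrace p)
    (hFW : ∃ (ℓ : ℕ) (_ : Fact ℓ.Prime), ℓ ≠ p ∧ W.HasMultiplicativeReductionAtPrime ℓ ∧
        ¬ W.HasSplitMultiplicativeReductionAtPrime ℓ ∧ ¬ p ∣ padicValInt ℓ W.minimalDiscriminantInt)
    (hr : W.analyticRank = 0) : BSDp W p := by
  haveI : NeZero (W.conductorNorm ℤ) := ⟨(W.conductorNorm_pos_holds).ne'⟩
  have hirr : Irr W p :=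
    hasIrreducibleModPGaloisRep_of_dvd_frobeniusTrace W p hp
      (W.not_dvd_minimalDiscriminantInt_of_hasGoodReductionAtPrime' p hgood) hss
  obtain ⟨f, hf⟩ := hnf W
  obtain ⟨q, hq, hv⟩ := hFW_OPEN W p hp hgood hss hirr hFW hr f hf
  -- the period comparison `Ω_E = u · Ω⁺_f`, `|u|_p = 1` (at `p = 3` and at `p ≥ 5`)
  obtain ⟨u, hu, hΩ⟩ : ∃ u : ℚ, ‖(u : ℚ_[p])‖ = 1 ∧ W.realPeriodRat = u * plusPeriod f := by
    rcases Nat.lt_or_ge p 5 with hlt | hge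
    · have hpP : p.Prime := Fact.out
      have h2 := hpP.two_le
      have hp3 : p = 3 := by
        interval_cases p
        · exact absurd rfl hp
        · rfl
        · exact absurd hpP (by decide)
      subst hp3
      exact h3 W hgood hirr f hf
    · exact h5 W p hge hgood hirr f hf
  have hu0 : u ≠ 0 := by
    intro h0
    rw [h0, Rat.cast_zero, norm_zero] at hu
    exact zero_ne_one hu
  have hvu : padicValRat p u = 0 := padicValRat_eq_zero_of_norm_ratCast_eq_one hu
  have hplus : ((plusPeriod f : ℝ) : ℂ) ≠ 0 := by
    have hΩpos : 0 < W.realPeriodRat := W.realPeriodRat_pos_holds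
    intro h0
    have h0' : plusPeriod f = 0 := by exact_mod_cast h0
    rw [h0', mul_zero] at hΩ
    exact hΩpos.ne' hΩ
  refine bsdp_of_padicVal_printShape_rankZero W p hGZK hr hirr ⟨q / u, ?_, ?_⟩
  · -- `L(E,1)/Ω_E = (L(E,1)/Ω⁺_f) / u`
    have huC : ((u : ℚ) : ℂ) ≠ 0 := by exact_mod_cast hu0
    rw [hΩ]
    push_cast
    rw [← hq]
    field_simp
  · by_cases hq0 : q = 0
    · subst hq0
      simp only [zero_div, padicValRat.zero] at hv ⊢
      exact hv
    · rw [padicValRat.div hq0 hu0, hvu, sub_zero, hv]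

/-- **Corner X7 (non-semistable, good supersingular), analytic rank 0, on the Fouquet–Wan locus: the
conditional class theorem (CLOSES NOTHING).** IF the claimed Cor. 5.4 of Fouquet–Wan holds
(`hFW_OPEN`, unrefereed), then at every X7 pair `(E,p)` with `p ≠ 2`, `ord_{s=1}L(E,s) = 0` and a
non-split multiplicative prime `ℓ ≠ p` with `p ∤ ord_ℓ(Δ_min)` — the planner's "FW locus" of route
`SignedLowerHalves` crux `KobayashiLowerHalfLargeImage` (census: 87 of the 233 open rank-0 X7 pairs,
all of surjective image) — Miller's `BSD(E,p)` follows from published inputs by name. CONDITIONAL.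
[claim: FouquetWan2021, status: under-review] [cite: Miller2011LMS, §1 and Def. 1.1] -/
theorem X7.bsdp_of_cor54_OPEN_of_analyticRank_eq_zero (hFW_OPEN : cor54_pPart_rankZero_OPEN)
    (hnf : exists_isNewformOf) (hGZK : rank_eq_analyticRank_of_analyticRank_le_one)
    (h5 : realPeriodRat_eq_unit_mul_plusPeriod) (h3 : realPeriodRat_eq_unit_mul_plusPeriod_three)
    (W : WeierstrassCurve ℚ) [W.IsElliptic] [W.IsGloballyMinimal] (p : ℕ) [Fact p.Prime]
    (hp : p ≠ 2) (hX : ClassX7 W p)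
    (hFW : ∃ (ℓ : ℕ) (_ : Fact ℓ.Prime), ℓ ≠ p ∧ W.HasMultiplicativeReductionAtPrime ℓ ∧
        ¬ W.HasSplitMultiplicativeReductionAtPrime ℓ ∧ ¬ p ∣ padicValInt ℓ W.minimalDiscriminantInt)
    (hr : W.analyticRank = 0) : BSDp W p :=
  _root_.Literature.NumberTheory.EllipticCurves.FouquetWan2021.bsdp_of_cor54_OPEN_of_analyticRank_eq_zero
    hFW_OPEN hnf hGZK h5 h3 W p hp hX.1.1 hX.1.2 hFW hr


/-! ### APPEND (cell `bsd-ssimc`, seat `bsd-ssimc-k3-c5` gen 2, 2026-08-26): Cor. 5.3 (= Cor. 1.9) — the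
CLAIMED corank-zero converse «`Sel_ℚ(f)` finite ⟺ `L(f,k/2) ≠ 0`» on the same locus, as a second OPEN binder

Source (read 2026-08-26 from the held text `paper:arxiv-2107.13726`, chunk p0006 = Cor. 1.9 with the
definition of `Sel_ℚ(f)`, chunk p0053 = Cor. 5.3 and its proof). Verbatim (p0006/p0053):

> «Write `V` for `M(f)_{ét,𝔭}(k/2)` and let `T ⊂ V` be a `G_ℚ`-stable `𝒪`-lattice. For `ℓ` a rational prime,
> define `H¹_f(G_{ℚ_ℓ},V)` as in [BlochKato] and put
> `Sel_ℚ(f) = ker(H¹(G_ℚ,V/T) → ∏_ℓ H¹(G_{ℚ_ℓ},V/T)/image(H¹_f(G_{ℚ_ℓ},V)))`.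
> **Corollary 5.3** (= 1.9). Let `f ∈ S_k(Γ₀(N))` be a normalized eigencuspform satisfying all the hypotheses
> of theorem 5.1. Then `Sel_ℚ(f)` is a finite group if and only if `L(f,k/2) ≠ 0`.»
> (p0006:) «Corollary 1.9 is a converse of [KatoEuler], which established that `Sel_ℚ(f)` is a finite group
> if `L(f,k/2) ≠ 0`.» Printed proof (p0053): from Thm. 5.1 (Kato's main conjecture (ConjIMC) for `M(f)`):
> if `z(f)_Iw` specialises to `0` at the trivial character then `γ − 1 ∈ char H²_ét(ℤ[1/p], T(f)_Iw)` and
> `corank Sel_ℚ(f) > 0`; otherwise `z(f)` spans a line in `H¹_f(G_{ℚ,Σ}, V(f)(k/2))` and again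
> `corank Sel_ℚ(f) ≥ 1`.

Transcription for an ELLIPTIC CURVE at an odd prime `p` of GOOD SUPERSINGULAR reduction, on the same locus
and with the same dictionary as `cor54_pPart_rankZero_OPEN` above (`k = 2`, `r = 0`; the third bullet of
Thm. 5.1 = a prime `ℓ ≠ p` of NON-SPLIT multiplicative reduction with `p ∤ ord_ℓ(Δ_min)`; `Irr W p` printed,
automatic here): the Bloch–Kato Selmer group of `V_pE/T_pE` is `Sel_{p^∞}(E/ℚ)` (Bloch–Kato 1990 Ex. 3.11:
`H¹_f = ` the Kummer image at every `ℓ`), the tree's `W.selmerGroupPInfty p`; «finite group» = `Finite`;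
«`L(f,1) ≠ 0`» = `W.analyticRank = 0`. PURPOSE: route `SignedLowerHalves`, crux `SprungLowerHalfAtThree`
(item stmt-BirchSwinnertonDyer-19003) is typed rank-free, and its divisibility clause at a pair with
`Sel_{3^∞}(E/ℚ)` finite FORCES `L(E,1) ≠ 0` (Theorems file
`SignedLowerHalvesSprungLowerHalfAtThreeChromaticReduction`, (conv₀)); this binder is the printed (PRE)
claim of exactly that converse on the Fouquet–Wan locus, so that clause can be read there at EVERY analytic
rank. Same AUDIT POINTER and FRESHNESS as `cor54_pPart_rankZero_OPEN` (one printed proof, Thm. 5.1, behind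
both corollaries). Nothing is asserted. -/

/-- **OPEN HYPOTHESIS — UNREFEREED PREPRINT (Fouquet–Wan, arXiv:2107.13726, 2021), Cor. 5.3 (= Cor. 1.9)
with Thm. 5.1, for an elliptic curve at a good supersingular prime.** «Let `f ∈ S_k(Γ₀(N))` be a
normalized eigencuspform satisfying all the hypotheses of theorem 5.1 [`p ≥ 3`; `ρ̄_f` absolutely
irreducible; `ρ̄_f|G_{ℚ_p}`ˢˢ `≠ χ̄ ⊕ χ̄_cyc χ̄`; there is `ℓ ∤ p`, `ℓ ∥ N`, with `ρ̄_f|G_{ℚ_ℓ}` a RAMIFIED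
extension of `μχ_cyc^{−k/2}` by `μχ_cyc^{1−k/2}`, `μ` unramified quadratic, non-trivial if `ρ̄_f|G_{ℚ_p}`
is irreducible]. Then `Sel_ℚ(f)` is a finite group if and only if `L(f,k/2) ≠ 0`.» Transcribed for a
globally minimal `W` (`f` = its newform, `k = 2`) at an ODD prime `p` of GOOD SUPERSINGULAR reduction
(`p ∣ a_p`; `ρ̄|G_{ℚ_p}` irreducible, so the `ℓ`-condition is a prime `ℓ ≠ p` of NON-SPLIT multiplicative
reduction with `p ∤ ord_ℓ(Δ_min)`), `E[p]` irreducible (`Irr W p`, printed): `Sel_{p^∞}(E/ℚ)`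
(`W.selmerGroupPInfty p`, the Bloch–Kato Selmer group of `V_pE/T_pE`) is finite iff `ord_{s=1} L(E,s) = 0`.
The direction «`L(E,1) ≠ 0` ⇒ finite» is Kato's theorem; the converse is the CLAIM. NEVER cite this `Prop`
as a theorem (FRESHNESS 2026-08-26: arXiv only; same exposure as `cor54_pPart_rankZero_OPEN`); take it as an
explicit hypothesis. [claim: FouquetWan2021, status: under-review] -/
def cor53_finiteSelmer_iff_rankZero_OPEN : Prop :=
  ∀ (W : WeierstrassCurve ℚ) [W.IsElliptic] [W.IsGloballyMinimal] (p : ℕ) [Fact p.Prime],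
    p ≠ 2 → W.HasGoodReductionAtPrime p → (p : ℤ) ∣ W.frobeniusTrace p → Irr W p →
    (∃ (ℓ : ℕ) (_ : Fact ℓ.Prime), ℓ ≠ p ∧ W.HasMultiplicativeReductionAtPrime ℓ ∧
        ¬ W.HasSplitMultiplicativeReductionAtPrime ℓ ∧ ¬ p ∣ padicValInt ℓ W.minimalDiscriminantInt) →
    (Finite (W.selmerGroupPInfty p) ↔ W.analyticRank = 0)

/-- **Conditional corank-zero converse on the Fouquet–Wan locus (CLOSES NOTHING).** IF the claimed Cor. 5.3
of Fouquet–Wan (`hFW53_OPEN`, unrefereed) holds, then for a globally minimal `W/ℚ`, an odd prime `p` of good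
supersingular reduction (`p ∣ a_p`) and a prime `ℓ ≠ p` of non-split multiplicative reduction with
`p ∤ ord_ℓ(Δ_min)`: `Sel_{p^∞}(E/ℚ)` finite ⇒ `ord_{s=1} L(E,s) = 0`; `E[p]` is irreducible at an odd
supersingular prime (Serre 1972 Prop. 12, tree theorem), so no (irr) binder. CONDITIONAL.
[claim: FouquetWan2021, status: under-review] [cite: Serre1972, §1.11 Prop. 12] -/
theorem analyticRank_eq_zero_of_finite_selmer_of_cor53_OPEN
    (hFW53_OPEN : cor53_finiteSelmer_iff_rankZero_OPEN)
    (W : WeierstrassCurve ℚ) [W.IsElliptic] [W.IsGloballyMinimal] (p : ℕ) [Fact p.Prime]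
    (hp : p ≠ 2) (hgood : W.HasGoodReductionAtPrime p) (hss : (p : ℤ) ∣ W.frobeniusTrace p)
    (hFW : ∃ (ℓ : ℕ) (_ : Fact ℓ.Prime), ℓ ≠ p ∧ W.HasMultiplicativeReductionAtPrime ℓ ∧
        ¬ W.HasSplitMultiplicativeReductionAtPrime ℓ ∧ ¬ p ∣ padicValInt ℓ W.minimalDiscriminantInt)
    (hfin : Finite (W.selmerGroupPInfty p)) : W.analyticRank = 0 := by
  have hirr : Irr W p :=
    hasIrreducibleModPGaloisRep_of_dvd_frobeniusTrace W p hp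
      (W.not_dvd_minimalDiscriminantInt_of_hasGoodReductionAtPrime' p hgood) hss
  exact (hFW53_OPEN W p hp hgood hss hirr hFW).1 hfin

/-- **Contrapositive reading (CLOSES NOTHING)**: on the same locus, IF Cor. 5.3 holds, then
`ord_{s=1} L(E,s) ≥ 1` forces `Sel_{p^∞}(E/ℚ)` to be INFINITE (positive corank) — the `p`-adic shadow of
«rank ≥ 1» that the rank-free typing of crux `SprungLowerHalfAtThree` needs off analytic rank `0`.
CONDITIONAL. [claim: FouquetWan2021, status: under-review] [cite: Serre1972, §1.11 Prop. 12] -/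
theorem not_finite_selmer_of_analyticRank_ne_zero_of_cor53_OPEN
    (hFW53_OPEN : cor53_finiteSelmer_iff_rankZero_OPEN)
    (W : WeierstrassCurve ℚ) [W.IsElliptic] [W.IsGloballyMinimal] (p : ℕ) [Fact p.Prime]
    (hp : p ≠ 2) (hgood : W.HasGoodReductionAtPrime p) (hss : (p : ℤ) ∣ W.frobeniusTrace p)
    (hFW : ∃ (ℓ : ℕ) (_ : Fact ℓ.Prime), ℓ ≠ p ∧ W.HasMultiplicativeReductionAtPrime ℓ ∧
        ¬ W.HasSplitMultiplicativeReductionAtPrime ℓ ∧ ¬ p ∣ padicValInt ℓ W.minimalDiscriminantInt)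
    (hr : W.analyticRank ≠ 0) : ¬ Finite (W.selmerGroupPInfty p) := fun hfin ↦
  hr (analyticRank_eq_zero_of_finite_selmer_of_cor53_OPEN hFW53_OPEN W p hp hgood hss hFW hfin)

end Literature.NumberTheory.EllipticCurves.FouquetWan2021

end
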